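import Literature.MathematicalPhysics.QuantumFieldTheory.Balaban1983to89.Node00.TkNoExpansionAtRecord13
import Literature.MathematicalPhysics.QuantumFieldTheory.Balaban1983to89.Node00.TkNoExpansionStepZeroAtTheta
import Literature.MathematicalPhysics.QuantumFieldTheory.Balaban1983to89.Node00.Record13LiveSelectorFamily

/-!
# NODE 00 — THE LEVEL-1 NO-EXPANSION COHERENCE EQUATION AT A STAGE-13 PARAMETER CARRYING K0b's RESIDUAL 𝐓-WEIGHTS, IN CLOSED FORM:
# at every `θ : Stage13Params` with `θ.Zt = ZtOfRecord` and the letters' junction `cR·ε₀ ≤ ε₀^{reg}·η₀²`, the right-hand integrand of (S1ᵀ)₁₃,₀ at the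
# all-large-field sequence IS `(#{Y})⁻¹ · 𝟙{U cR·ε₀-regular} · e^{A_1(s′)(U)}` — both branches —, hence at K0a's Stage-13 witnesses of the family
# `theta13LiveOfFamily ε₀ ζ Rz ZtOfRecord` (junction DISCHARGED for every `ε₀` and every `g₀ ≥ 0`) and at the witness of record `theta13LiveOfRecord`

Cell `pub-ymgap`, YM-PLAN Track A (HUMAN RULING D-0062); author seat `pub-ymgap-dag-n11-d` (g4; R134 fan-out seat N11 [B14], strategy s2), lineage item K1′
`StabilityBAtRecordR12e` = stmt-QuantumFields-19903 → K1‴ at rev 16.  Sequel of this seat's `Node00.TkNoExpansionAtRecord13` (the ₁₃ coherence equations) and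
`Node00.TkNoExpansionStepZeroAtTheta` (g3: the Stage-12 reading at `theta12OfRecord`), over K0a's `Node00.Record13LiveSelector` ∕ `…Family` (FILES 8–9: the
Stage-13 witnesses `theta13LiveOfFamily F N ε₀ ζ Rz Zt`, `theta13LiveOfFamily₂ F N ε₀ ε₂₉ ζ Rz Zt`, `theta13LiveOfNumerics F N n ε₂₉ ζ Rz Zt`, `theta13LiveOfRecord F N`)
and K0b's `Node00.Record12Residuals` (`ZtOfRecord`, `Stage12Params.HasResidualsOfRecord`).
[III] = [Balaban1988Convergent], [I] = [Balaban1987RG1].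

WHY.  The route's rev-16 crux K0‴ is reduced to ONE row (P11 `bg`) AT K0a's witness of record `theta13LiveOfRecord` (`exists_k0_of_bg_theta13LiveOfRecord`), whose
residual 𝐓-weights are K0b's `ZtOfRecord` (uniform `ζ0 = (#{Y ⊂ T})⁻¹`, unit-covariance placeholder `quad`); K1‴'s `stub_nodes13` then wants the thirteen nodes at
SOME Stage-13 record, and node N11 there is (S1ᵀ)₁₃ at the chosen `θ` (this seat's `BalabanUVNodesN11AtRecord13C.b14_main_at_record₁₃`).  This file makes the
FIRST instance of (S1ᵀ)₁₃ — `TLaw₁₃ θ p 0` at the all-large-field new sequence `s′` (`Ω₁(s′) = ∅`) — fully explicit at every `θ` of that residual class: the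
right-hand integrand of the coherence equation (`TkNoExpansionAtRecord13.tLaw₁₃_zero_coherence_of_Omega_empty`) is, at BOTH branches of p. 256's regularity factor,
the closed form `(#{Y})⁻¹ · χreg_0(T)(U) · e^{A_1(s′)(U)}` — the residual factor a constant, the Gaussian placeholder `1` at the empty domain, the background of
record the fine field `U` itself —, so that (S1ᵀ)₁₃,₀ there READS, `dV₁`-a.e.,
`∫dU δ(ŪV₁⁻¹) w(s′)(U,V₁)·ρ₀(U) = (#{Y})⁻¹ ∫dU δ(ŪV₁⁻¹) 𝟙{U cR·ε₀-regular}·e^{A_1(s′)(U)}` (or `slotT_1(s′) ≡ 0`): the left side carries def-T's (3.2)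
large-field indicators of `V₁`, the right side none (dag-n11-d g2's reading (ii), pub-ymgap INBOX l.14524, at the Stage-13 witnesses).  The generic form (θ with
`θ.Zt = ZtOfRecord`, junction displayed) serves EVERY member of K0a's witness families — `theta13LiveOfFamily`, and the all-numerics family `theta13LiveOfNumerics n
ε₂₉ ζ Rz ZtOfRecord` of K0a's FILE 9 with the junction `n.s2.cR·ε₀(g₀) ≤ n.ν.εreg·η₀²` as ITS displayed numerics condition — by `rfl` on `Zt`.

WHAT THIS FILE PROVES (0 `sorry`, 0 `def`, 0 `instance`, 0 `notation`; `N`-generic).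
§1 `lettersJunction_numericsOfFamily` (the junction `cR·ε₀(g₀) ≤ ε₀^{reg}·η₀²` holds at the numerics OF THE FAMILY `numerics7OfFamily ε₀` ∕ `sect2NumericsOfFamily` for
   EVERY threshold `ε₀` and every `g₀ ≥ 0` — it reads only `cR = εreg = A₀ = p₀ = 1`: `g₀·log(g₀⁻²) ≤ 1`, g3's `lettersJunction_numericsOfRecord₁₂` by `rfl` on the
   letters); `Zt_theta13LiveOfFamily` (`rfl`); `lettersJunction_theta13LiveOfFamily` ∕ `lettersJunction_theta13LiveOfRecord`.
§2 GENERIC `θ : Stage13Params` WITH `θ.Zt = ZtOfRecord` and the junction displayed: **`noExpIntegrand_WtOfRecord₁₃_sect2Operand_of_Zt_eq_ZtOfRecord`** (THE CLOSED FORM,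
   both branches: `noExpIntegrand (WtOfRecord₁₃ θ p) (exp A_1(s′) at UbgOfRecord₁₃ θ p 1 s′) V₁ U = (#{Y})⁻¹ · χreg_0(T)(U,V₁) · e^{A_1(s′)(U)}`);
   `…_of_hasResidualsOfRecord` (the same keyed on K0b's `HasResidualsOfRecord`); **`tLaw₁₃_zero_coherence_of_Zt_eq_ZtOfRecord`** (THE COHERENCE EQUATION IN CLOSED
   FORM: `slotT_1(s′) ≡ 0 ∨ T[w(s′)ρ₀] =ᵐ T[(#{Y})⁻¹·χreg·e^{A_1(s′)}]`, measurability ∕ bound displayed ON THE CLOSED-FORM integrand, `0 < K`).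
§3 AT K0a's WITNESSES: `noExpIntegrand_theta13LiveOfFamily` ∕ **`tLaw₁₃_zero_coherence_theta13LiveOfFamily`** (every `ε₀`, `ζ`, `Rz`; `Zt := ZtOfRecord`; runs with
   `0 ≤ g₀`; junction discharged) and `noExpIntegrand_theta13LiveOfRecord` ∕ **`tLaw₁₃_zero_coherence_theta13LiveOfRecord`** (the witness of record).
§4 AT K0a's FILE-9 FAMILIES: `Zt_theta13LiveOfFamily₂` ∕ `lettersJunction_theta13LiveOfFamily₂` ∕ **`tLaw₁₃_zero_coherence_theta13LiveOfFamily₂`** (both small-field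
   letters open; junction discharged) and `Zt_theta13LiveOfNumerics` ∕ **`tLaw₁₃_zero_coherence_theta13LiveOfNumerics`** (EVERY numeric letter open: the junction
   `n.s2.cR·ε₀(g₀) ≤ n.ν.εreg·η₀²` along the run is ITS displayed numerics condition — one more located line for a numerics re-pin keyed to [15]'s constants).
§5 (v1.1) EVERY LEVEL: `noExpIntegrandAt_WtOfRecord₁₃_of_Zt_eq_ZtOfRecord` (the top-generation no-expansion integrand at level `k` in CLOSED FORM for every
   old-branch function `Ψ`: `(#{Y})⁻¹ · χreg_k(T)(U,V′) · Ψ(U,V′)` — no junction needed) and **`tLaw₁₃_coherence_of_Zt_eq_ZtOfRecord`** (THE LEVEL-(k+1)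
   COHERENCE EQUATION IN CLOSED FORM at a no-expansion `s′`: `slotT_{k+1}(s′) ≡ 0 ∨ T[w(s′)χ_k(init s′)𝐓_k(init s′)e^{A_k(init s′)}] =ᵐ
   Σ_S T[(#{Y})⁻¹·χreg_k(T)·𝐓_k(init s′,S)e^{A_{k+1}(s′)}_S]`, hm∕hC displayed on the closed form, `k < K`).

HONEST SCOPE.  Kernel bookkeeping on the tree's OWN objects; every identity PROVED by unfolding, the measure-theoretic face from displayed hypotheses.  A READING of
what (S1ᵀ)₁₃ demands at these witnesses — NOT a proof that it holds or fails there: `w` (def-T's resummed (3.2)·(3.3)·ζ-labels of record) and the operand's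
term values `(t, E_1)` (existentially quantified in `TLaw₁₃`) are not controlled here; no positivity-of-measure fact about the (3.2) regions is in the tree.  Nothing
of Bałaban's is asserted (Theorem p. 245, Thms 1–2 [III] are what would make `TLaw₁₃` TRUE at a correct witness); N11 and K0‴ are NOT discharged; no node count moves
(typed 28∕28 · discharged 5∕28).  One finite four-torus programme at fixed `ε = L^{−K}`, Bałaban AS PRINTED with locators; NOT ℝ⁴, NOT infinite volume, NOT OS, NOT a
mass gap, NOT the Clay problem.  Sources: [III] (2.4) p. 255, (2.10)–(2.12) p. 256, (2.18) p. 257, (2.21)–(2.23) p. 258, (3.1)–(3.2) pp. 264–265, (3.16) p. 268,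
(3.25) p. 270, Theorem p. 245; [I] (1.5) p. 261, (2.9) p. 266.
-/

noncomputable section

open MeasureTheory
open scoped Matrix.Norms.L2Operator

namespace Literature.MathematicalPhysics.QuantumFieldTheory.Balaban1983to89.Node00

open T4AveragingDisintegration T4Continuum T4FiniteEpsInhabited Tk B14.Eq218Concrete

/-! ## §1  The letters' junction at the numerics OF THE FAMILY and at K0a's Stage-13 witnesses -/

section Junction

variable (F : T4Family) (N : ℕ) [NeZero N]

/-- **THE LETTERS' JUNCTION HOLDS AT THE NUMERICS OF THE FAMILY, EVERY THRESHOLD `ε₀`**: `sect2NumericsOfFamily.cR · ε₀(g₀) ≤ (numerics7OfFamily ε₀).εreg · η₀²` for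
`g₀ ≥ 0` — the inequality reads only `cR = εreg = A₀ = p₀ = 1` (unchanged across the family: `numerics7OfFamily ε₀` re-pins `ε₀` alone, `sect2NumericsOfFamily` re-pins
`κ` alone), where it is `g₀·log(g₀⁻²) ≤ 1` (g3's `lettersJunction_numericsOfRecord₁₂`, by `rfl` on the letters). [cite: Balaban1988Convergent, (2.4) p.255, (2.10) p.256, (2.12) p.256] -/
theorem lettersJunction_numericsOfFamily (ε₀ : ℝ) (K : ℕ) (g : ℕ → ℝ) (hg : 0 ≤ g 0) :
    sect2NumericsOfFamily.cR * epsOfRecord (numerics7OfFamily ε₀) g 0 ≤ (numerics7OfFamily ε₀).εreg * (F.P K).eta 0 ^ 2 :=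
  lettersJunction_numericsOfRecord₁₂ F K g hg

variable (ε₀ : ℝ) (ζ : ZetaOfRecord F N (numerics7OfFamily ε₀) 1) (Rz : (K : ℕ) → Sect2.Residual (F.P K) (MatA N))
  (Zt : (K : ℕ) → TkResidualW F N (FluctV N) K)

/-- K0a's Stage-13 witness of the family carries its residual 𝐓-weight ARGUMENT (`rfl`). [cite: Balaban1988Convergent, (2.21) p.258 (bookkeeping witness)] -/
theorem Zt_theta13LiveOfFamily : (theta13LiveOfFamily F N ε₀ ζ Rz Zt).Zt = Zt := rfl

/-- **THE JUNCTION AT K0a's STAGE-13 WITNESS OF THE FAMILY** along every run with `0 ≤ g₀` (`g_0 = g₀`: `genSeq_zero` along `gOfRecord₁₃`).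
[cite: Balaban1988Convergent, (2.4) p.255, (2.10) p.256, (2.12) p.256] -/
theorem lettersJunction_theta13LiveOfFamily (p : B12.RunParams) (hg : 0 ≤ p.g0) :
    (theta13LiveOfFamily F N ε₀ ζ Rz Zt).s2.cR *
        epsOfRecord (theta13LiveOfFamily F N ε₀ ζ Rz Zt).ν (gOfRecord₁₃ F N (theta13LiveOfFamily F N ε₀ ζ Rz Zt) p) 0 ≤
      (theta13LiveOfFamily F N ε₀ ζ Rz Zt).ν.εreg * (F.P p.K).eta 0 ^ 2 := by
  have h0 : gOfRecord₁₃ F N (theta13LiveOfFamily F N ε₀ ζ Rz Zt) p 0 = p.g0 := FlowStepRuns.genSeq_zero _ _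
  exact lettersJunction_numericsOfFamily F ε₀ p.K (gOfRecord₁₃ F N (theta13LiveOfFamily F N ε₀ ζ Rz Zt) p) (by rw [h0]; exact hg)

/-- **… AND AT THE WITNESS OF RECORD `theta13LiveOfRecord`** (`ε₀ := 1`, K0b's residuals). [cite: Balaban1988Convergent, (2.4) p.255, (2.10) p.256, (2.12) p.256] -/
theorem lettersJunction_theta13LiveOfRecord (p : B12.RunParams) (hg : 0 ≤ p.g0) :
    (theta13LiveOfRecord F N).s2.cR * epsOfRecord (theta13LiveOfRecord F N).ν (gOfRecord₁₃ F N (theta13LiveOfRecord F N) p) 0 ≤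
      (theta13LiveOfRecord F N).ν.εreg * (F.P p.K).eta 0 ^ 2 :=
  lettersJunction_theta13LiveOfFamily F N eps0OfRecord₁₃ _ _ _ p hg

end Junction

/-! ## §2  GENERIC: the right-hand integrand of the level-1 coherence equation at a `θ` carrying K0b's residual 𝐓-weights, IN CLOSED FORM, and the equation -/

section Generic

variable {F : T4Family} {N : ℕ} [NeZero N]
variable (θ : Stage13Params F N) (p : B12.RunParams)

/-- **THE CLOSED FORM OF THE NO-EXPANSION INTEGRAND AT A STAGE-13 PARAMETER WITH `θ.Zt = ZtOfRecord`** (both branches of p. 256's regularity factor): under the letters'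
junction `cR·ε₀(g₀) ≤ ε₀^{reg}·η₀²` (displayed), at the all-large-field new sequence `s′` (`Ω₁(s′) = ∅`), for every term-value witness `(t, E_1)` and every two-scale
configuration `(U, V₁)`,
`noExpIntegrand (WtOfRecord₁₃ θ p) (exp A_1(s′) at UbgOfRecord₁₃ θ p 1 s′) V₁ U = (#{Y ⊂ T})⁻¹ · χreg_0(T)(U, V₁) · e^{A_1(s′)(U)}` — on the regular set the residual
factor is K0b's constant, the Gaussian placeholder `e^{−½quad_0(∅)} = 1`, and the background of record is the fine field `U` (`…AtRecord13 …_of_chiRegW_ne_zero`);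
off it both sides vanish (`…_eq_zero_of_chiRegW_eq_zero`). [cite: Balaban1988Convergent, (2.10) p.256, (2.12) p.256, (2.18) p.257, (2.21)–(2.23) p.258, (3.16) p.268; Balaban1987RG1, (1.5) p.261] -/
theorem noExpIntegrand_WtOfRecord₁₃_sect2Operand_of_Zt_eq_ZtOfRecord (hZt : θ.Zt = ZtOfRecord F N)
    (hc : θ.s2.cR * epsOfRecord θ.ν (gOfRecord₁₃ F N θ p) 0 ≤ θ.ν.εreg * (F.P p.K).eta 0 ^ 2)
    (s : SeqOfRecord F θ.ν θ.τ9.M (gOfRecord₁₃ F N θ p) p.K 1) (hΩ : s.Ω 1 = ∅)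
    (t : Sect2.TermValues (F.P p.K) (MatA N) (FluctV N) θ.τ9.M) (Ek : ℝ) (V1 : GaugeField (F.P p.K) 1 (SU N)) (Uf : GaugeField (F.P p.K) 0 (SU N)) :
    noExpIntegrand F N (FluctV N) p.K (WtOfRecord₁₃ F N θ p)
        (sect2Operand F N (FluctV N) p.K (settingOfRecord₁₃ F N θ p) (θ.Rz p.K) s t Ek (UbgOfRecord₁₃ F N θ p 1 s)) V1 Uf =
      ((Nat.card (Set (Site (F.P p.K) 0)) : ℝ))⁻¹ *
          chiRegW F N (FluctV N) θ.ν θ.s2.cR p (gOfRecord₁₃ F N θ p) 0 Set.univ (pairCfg (V := FluctV N) V1 Uf) *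
        Real.exp ((sect2ActionDataOfRecord F N (FluctV N) p.K (settingOfRecord₁₃ F N θ p) (θ.Rz p.K) s t
          (fun _ => ∅, fun j => (pairCfg (V := FluctV N) V1 Uf j).2) Ek).action23 1 Uf) := by
  by_cases h : chiRegW F N (FluctV N) θ.ν θ.s2.cR p (gOfRecord₁₃ F N θ p) 0 Set.univ (pairCfg (V := FluctV N) V1 Uf) ≠ 0
  · rw [noExpIntegrand_WtOfRecord₁₃_sect2Operand_of_chiRegW_ne_zero θ p hc s hΩ t Ek V1 Uf h, hZt, ZtOfRecord_ζ0_apply, ZtOfRecord_quad_empty,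
      mul_zero, Real.exp_zero, one_mul]
  · rw [not_not] at h
    rw [noExpIntegrand_WtOfRecord₁₃_eq_zero_of_chiRegW_eq_zero θ p _ V1 Uf h, h, mul_zero, zero_mul]

/-- **… KEYED ON K0b's `HasResidualsOfRecord`** (`θ.Zt = ZtOfRecord` is its third conjunct; K0a's witnesses carry it by `⟨rfl, rfl, rfl⟩`).
[cite: Balaban1988Convergent, (2.10) p.256, (2.18) p.257, (2.21)–(2.23) p.258, (3.16) p.268] -/
theorem noExpIntegrand_WtOfRecord₁₃_sect2Operand_of_hasResidualsOfRecord (hres : θ.HasResidualsOfRecord F N)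
    (hc : θ.s2.cR * epsOfRecord θ.ν (gOfRecord₁₃ F N θ p) 0 ≤ θ.ν.εreg * (F.P p.K).eta 0 ^ 2)
    (s : SeqOfRecord F θ.ν θ.τ9.M (gOfRecord₁₃ F N θ p) p.K 1) (hΩ : s.Ω 1 = ∅)
    (t : Sect2.TermValues (F.P p.K) (MatA N) (FluctV N) θ.τ9.M) (Ek : ℝ) (V1 : GaugeField (F.P p.K) 1 (SU N)) (Uf : GaugeField (F.P p.K) 0 (SU N)) :
    noExpIntegrand F N (FluctV N) p.K (WtOfRecord₁₃ F N θ p)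
        (sect2Operand F N (FluctV N) p.K (settingOfRecord₁₃ F N θ p) (θ.Rz p.K) s t Ek (UbgOfRecord₁₃ F N θ p 1 s)) V1 Uf =
      ((Nat.card (Set (Site (F.P p.K) 0)) : ℝ))⁻¹ *
          chiRegW F N (FluctV N) θ.ν θ.s2.cR p (gOfRecord₁₃ F N θ p) 0 Set.univ (pairCfg (V := FluctV N) V1 Uf) *
        Real.exp ((sect2ActionDataOfRecord F N (FluctV N) p.K (settingOfRecord₁₃ F N θ p) (θ.Rz p.K) s t
          (fun _ => ∅, fun j => (pairCfg (V := FluctV N) V1 Uf j).2) Ek).action23 1 Uf) :=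
  noExpIntegrand_WtOfRecord₁₃_sect2Operand_of_Zt_eq_ZtOfRecord θ p hres.Zt_eq hc s hΩ t Ek V1 Uf

/-- **THE LEVEL-1 COHERENCE EQUATION AT A `θ` WITH `θ.Zt = ZtOfRecord`, IN CLOSED FORM**: at `s′` with `Ω₁(s′) = ∅`, under the junction, for a witness pair
`(t, E_1)` of the (S1ᵀ)₁₃,₀ dichotomy there (`hcl`) and the displayed joint measurability ∕ bound OF THE CLOSED-FORM INTEGRAND (`0 < K`): EITHER `slotT_1(s′) ≡ 0` OR,
`dV₁`-a.e., `∫dU δ(ŪV₁⁻¹) w(s′)(U,V₁)·ρ₀(U) = ∫dU δ(ŪV₁⁻¹) (#{Y})⁻¹·χreg_0(T)(U,V₁)·e^{A_1(s′)(U)}` — def-T's step weights of record (the (3.2) large-field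
indicators of `V₁`) against a right side with NO indicator of `V₁` beyond regularity. [cite: Balaban1988Convergent, Theorem p.245, (3.1)–(3.2) pp.264–265, (3.25) p.270, (2.10) p.256, (2.21)–(2.23) p.258] -/
theorem tLaw₁₃_zero_coherence_of_Zt_eq_ZtOfRecord (hZt : θ.Zt = ZtOfRecord F N)
    (hc : θ.s2.cR * epsOfRecord θ.ν (gOfRecord₁₃ F N θ p) 0 ≤ θ.ν.εreg * (F.P p.K).eta 0 ^ 2) (hK : 0 < p.K)
    (s : SeqOfRecord F θ.ν θ.τ9.M (gOfRecord₁₃ F N θ p) p.K 1) (hΩ : s.Ω 1 = ∅)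
    (t : Sect2.TermValues (F.P p.K) (MatA N) (FluctV N) θ.τ9.M) (Ek : ℝ)
    (hcl : slotsTOfRecord F N θ.ν θ.τ9 (EOfRecord₁₃ F N θ) (wOfRecord₉ F N θ.toStage9Params) θ.ppSel p
          (gOfRecord₁₃ F N θ p) 1 s = 0 ∨
        ∀ᵐ V1 ∂fieldMeasure (F.P p.K) 1 (SU N),
          slotsTOfRecord F N θ.ν θ.τ9 (EOfRecord₁₃ F N θ) (wOfRecord₉ F N θ.toStage9Params) θ.ppSel p
              (gOfRecord₁₃ F N θ p) 1 s V1 =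
            sect2Slot F N (FluctV N) p.K (settingOfRecord₁₃ F N θ p) (θ.Rz p.K) (WtOfRecord₁₃ F N θ p) s t Ek
              (UbgOfRecord₁₃ F N θ p 1 s) V1)
    {C : ℝ}
    (hm : Measurable (Function.uncurry fun (V1 : GaugeField (F.P p.K) 1 (SU N)) (Uf : GaugeField (F.P p.K) 0 (SU N)) =>
      ((Nat.card (Set (Site (F.P p.K) 0)) : ℝ))⁻¹ *
          chiRegW F N (FluctV N) θ.ν θ.s2.cR p (gOfRecord₁₃ F N θ p) 0 Set.univ (pairCfg (V := FluctV N) V1 Uf) *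
        Real.exp ((sect2ActionDataOfRecord F N (FluctV N) p.K (settingOfRecord₁₃ F N θ p) (θ.Rz p.K) s t
          (fun _ => ∅, fun j => (pairCfg (V := FluctV N) V1 Uf j).2) Ek).action23 1 Uf)))
    (hC : ∀ (V1 : GaugeField (F.P p.K) 1 (SU N)) (Uf : GaugeField (F.P p.K) 0 (SU N)),
      |((Nat.card (Set (Site (F.P p.K) 0)) : ℝ))⁻¹ *
          chiRegW F N (FluctV N) θ.ν θ.s2.cR p (gOfRecord₁₃ F N θ p) 0 Set.univ (pairCfg (V := FluctV N) V1 Uf) *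
        Real.exp ((sect2ActionDataOfRecord F N (FluctV N) p.K (settingOfRecord₁₃ F N θ p) (θ.Rz p.K) s t
          (fun _ => ∅, fun j => (pairCfg (V := FluctV N) V1 Uf j).2) Ek).action23 1 Uf)| ≤ C) :
    slotsTOfRecord F N θ.ν θ.τ9 (EOfRecord₁₃ F N θ) (wOfRecord₉ F N θ.toStage9Params) θ.ppSel p
        (gOfRecord₁₃ F N θ p) 1 s = 0 ∨
      (fun V1 => transportOfRecord F N p.K 0 (fun U => wOfRecord₉ F N θ.toStage9Params p (gOfRecord₁₃ F N θ p) 0 s U V1 *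
          rhoZeroOfRecord F N p.K (gOfRecord₁₃ F N θ p 0) (EOfRecord₁₃ F N θ p) U) V1)
        =ᵐ[fieldMeasure (F.P p.K) 1 (SU N)]
      fun V1 => transportOfRecord F N p.K 0 (fun Uf =>
          ((Nat.card (Set (Site (F.P p.K) 0)) : ℝ))⁻¹ *
              chiRegW F N (FluctV N) θ.ν θ.s2.cR p (gOfRecord₁₃ F N θ p) 0 Set.univ (pairCfg (V := FluctV N) V1 Uf) *
            Real.exp ((sect2ActionDataOfRecord F N (FluctV N) p.K (settingOfRecord₁₃ F N θ p) (θ.Rz p.K) s t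
              (fun _ => ∅, fun j => (pairCfg (V := FluctV N) V1 Uf j).2) Ek).action23 1 Uf)) V1 := by
  have hI : noExpIntegrand F N (FluctV N) p.K (WtOfRecord₁₃ F N θ p)
      (sect2Operand F N (FluctV N) p.K (settingOfRecord₁₃ F N θ p) (θ.Rz p.K) s t Ek (UbgOfRecord₁₃ F N θ p 1 s)) =
      fun (V1 : GaugeField (F.P p.K) 1 (SU N)) (Uf : GaugeField (F.P p.K) 0 (SU N)) =>
        ((Nat.card (Set (Site (F.P p.K) 0)) : ℝ))⁻¹ *
            chiRegW F N (FluctV N) θ.ν θ.s2.cR p (gOfRecord₁₃ F N θ p) 0 Set.univ (pairCfg (V := FluctV N) V1 Uf) *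
          Real.exp ((sect2ActionDataOfRecord F N (FluctV N) p.K (settingOfRecord₁₃ F N θ p) (θ.Rz p.K) s t
            (fun _ => ∅, fun j => (pairCfg (V := FluctV N) V1 Uf j).2) Ek).action23 1 Uf) :=
    funext fun V1 => funext fun Uf => noExpIntegrand_WtOfRecord₁₃_sect2Operand_of_Zt_eq_ZtOfRecord θ p hZt hc s hΩ t Ek V1 Uf
  have h := tLaw₁₃_zero_coherence_of_Omega_empty θ p hK s hΩ t Ek hcl (C := C) (by rw [hI]; exact hm)
    (fun V1 Uf => by rw [hI]; exact hC V1 Uf)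
  rw [hI] at h
  exact h

end Generic

/-! ## §3  AT K0a's STAGE-13 WITNESSES: the family `theta13LiveOfFamily ε₀ ζ Rz ZtOfRecord` (junction discharged) and the witness of record -/

section AtWitness

variable (F : T4Family) (N : ℕ) [NeZero N]
variable (ε₀ : ℝ) (ζ : ZetaOfRecord F N (numerics7OfFamily ε₀) 1) (Rz : (K : ℕ) → Sect2.Residual (F.P K) (MatA N))

/-- **AT K0a's STAGE-13 WITNESS OF THE FAMILY WITH K0b's RESIDUAL 𝐓-WEIGHTS** (every threshold `ε₀`, every `ζ`, `Rz`; runs with `0 ≤ g₀`): the no-expansion integrand at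
the all-large-field sequence is `(#{Y})⁻¹ · χreg_0(T)(U,V₁) · e^{A_1(s′)(U)}` — the junction DISCHARGED at the numerics of the family.
[cite: Balaban1988Convergent, (2.4) p.255, (2.10) p.256, (2.12) p.256, (2.18) p.257, (2.21)–(2.23) p.258, (3.16) p.268] -/
theorem noExpIntegrand_theta13LiveOfFamily (p : B12.RunParams) (hg : 0 ≤ p.g0)
    (s : SeqOfRecord F (theta13LiveOfFamily F N ε₀ ζ Rz (ZtOfRecord F N)).ν (theta13LiveOfFamily F N ε₀ ζ Rz (ZtOfRecord F N)).τ9.M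
      (gOfRecord₁₃ F N (theta13LiveOfFamily F N ε₀ ζ Rz (ZtOfRecord F N)) p) p.K 1) (hΩ : s.Ω 1 = ∅)
    (t : Sect2.TermValues (F.P p.K) (MatA N) (FluctV N) (theta13LiveOfFamily F N ε₀ ζ Rz (ZtOfRecord F N)).τ9.M) (Ek : ℝ)
    (V1 : GaugeField (F.P p.K) 1 (SU N)) (Uf : GaugeField (F.P p.K) 0 (SU N)) :
    noExpIntegrand F N (FluctV N) p.K (WtOfRecord₁₃ F N (theta13LiveOfFamily F N ε₀ ζ Rz (ZtOfRecord F N)) p)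
        (sect2Operand F N (FluctV N) p.K (settingOfRecord₁₃ F N (theta13LiveOfFamily F N ε₀ ζ Rz (ZtOfRecord F N)) p)
          ((theta13LiveOfFamily F N ε₀ ζ Rz (ZtOfRecord F N)).Rz p.K) s t Ek
          (UbgOfRecord₁₃ F N (theta13LiveOfFamily F N ε₀ ζ Rz (ZtOfRecord F N)) p 1 s)) V1 Uf =
      ((Nat.card (Set (Site (F.P p.K) 0)) : ℝ))⁻¹ *
          chiRegW F N (FluctV N) (theta13LiveOfFamily F N ε₀ ζ Rz (ZtOfRecord F N)).ν (theta13LiveOfFamily F N ε₀ ζ Rz (ZtOfRecord F N)).s2.cR p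
            (gOfRecord₁₃ F N (theta13LiveOfFamily F N ε₀ ζ Rz (ZtOfRecord F N)) p) 0 Set.univ (pairCfg (V := FluctV N) V1 Uf) *
        Real.exp ((sect2ActionDataOfRecord F N (FluctV N) p.K (settingOfRecord₁₃ F N (theta13LiveOfFamily F N ε₀ ζ Rz (ZtOfRecord F N)) p)
          ((theta13LiveOfFamily F N ε₀ ζ Rz (ZtOfRecord F N)).Rz p.K) s t (fun _ => ∅, fun j => (pairCfg (V := FluctV N) V1 Uf j).2) Ek).action23 1 Uf) :=
  noExpIntegrand_WtOfRecord₁₃_sect2Operand_of_Zt_eq_ZtOfRecord _ p (Zt_theta13LiveOfFamily F N ε₀ ζ Rz (ZtOfRecord F N))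
    (lettersJunction_theta13LiveOfFamily F N ε₀ ζ Rz (ZtOfRecord F N) p hg) s hΩ t Ek V1 Uf

/-- **THE LEVEL-1 COHERENCE EQUATION AT K0a's STAGE-13 WITNESS OF THE FAMILY, CLOSED FORM** (every `ε₀`, `ζ`, `Rz`; `Zt := ZtOfRecord`; `0 ≤ g₀`, `0 < K`): what
(S1ᵀ)₁₃,₀ demands there at the all-large-field sequence — `slotT_1(s′) ≡ 0` or, `dV₁`-a.e.,
`∫dU δ(ŪV₁⁻¹) w(s′)(U,V₁)·ρ₀(U) = ∫dU δ(ŪV₁⁻¹) (#{Y})⁻¹·χreg_0(T)(U,V₁)·e^{A_1(s′)(U)}`. [cite: Balaban1988Convergent, Theorem p.245, (3.1)–(3.2) pp.264–265, (3.25) p.270, (2.10) p.256, (2.21)–(2.23) p.258] -/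
theorem tLaw₁₃_zero_coherence_theta13LiveOfFamily (p : B12.RunParams) (hg : 0 ≤ p.g0) (hK : 0 < p.K)
    (s : SeqOfRecord F (theta13LiveOfFamily F N ε₀ ζ Rz (ZtOfRecord F N)).ν (theta13LiveOfFamily F N ε₀ ζ Rz (ZtOfRecord F N)).τ9.M
      (gOfRecord₁₃ F N (theta13LiveOfFamily F N ε₀ ζ Rz (ZtOfRecord F N)) p) p.K 1) (hΩ : s.Ω 1 = ∅)
    (t : Sect2.TermValues (F.P p.K) (MatA N) (FluctV N) (theta13LiveOfFamily F N ε₀ ζ Rz (ZtOfRecord F N)).τ9.M) (Ek : ℝ)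
    (hcl : slotsTOfRecord F N (theta13LiveOfFamily F N ε₀ ζ Rz (ZtOfRecord F N)).ν (theta13LiveOfFamily F N ε₀ ζ Rz (ZtOfRecord F N)).τ9
          (EOfRecord₁₃ F N (theta13LiveOfFamily F N ε₀ ζ Rz (ZtOfRecord F N)))
          (wOfRecord₉ F N (theta13LiveOfFamily F N ε₀ ζ Rz (ZtOfRecord F N)).toStage9Params)
          (theta13LiveOfFamily F N ε₀ ζ Rz (ZtOfRecord F N)).ppSel p
          (gOfRecord₁₃ F N (theta13LiveOfFamily F N ε₀ ζ Rz (ZtOfRecord F N)) p) 1 s = 0 ∨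
        ∀ᵐ V1 ∂fieldMeasure (F.P p.K) 1 (SU N),
          slotsTOfRecord F N (theta13LiveOfFamily F N ε₀ ζ Rz (ZtOfRecord F N)).ν (theta13LiveOfFamily F N ε₀ ζ Rz (ZtOfRecord F N)).τ9
              (EOfRecord₁₃ F N (theta13LiveOfFamily F N ε₀ ζ Rz (ZtOfRecord F N)))
              (wOfRecord₉ F N (theta13LiveOfFamily F N ε₀ ζ Rz (ZtOfRecord F N)).toStage9Params)
              (theta13LiveOfFamily F N ε₀ ζ Rz (ZtOfRecord F N)).ppSel p
              (gOfRecord₁₃ F N (theta13LiveOfFamily F N ε₀ ζ Rz (ZtOfRecord F N)) p) 1 s V1 =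
            sect2Slot F N (FluctV N) p.K (settingOfRecord₁₃ F N (theta13LiveOfFamily F N ε₀ ζ Rz (ZtOfRecord F N)) p)
              ((theta13LiveOfFamily F N ε₀ ζ Rz (ZtOfRecord F N)).Rz p.K)
              (WtOfRecord₁₃ F N (theta13LiveOfFamily F N ε₀ ζ Rz (ZtOfRecord F N)) p) s t Ek
              (UbgOfRecord₁₃ F N (theta13LiveOfFamily F N ε₀ ζ Rz (ZtOfRecord F N)) p 1 s) V1)
    {C : ℝ}
    (hm : Measurable (Function.uncurry fun (V1 : GaugeField (F.P p.K) 1 (SU N)) (Uf : GaugeField (F.P p.K) 0 (SU N)) =>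
      ((Nat.card (Set (Site (F.P p.K) 0)) : ℝ))⁻¹ *
          chiRegW F N (FluctV N) (theta13LiveOfFamily F N ε₀ ζ Rz (ZtOfRecord F N)).ν (theta13LiveOfFamily F N ε₀ ζ Rz (ZtOfRecord F N)).s2.cR p
            (gOfRecord₁₃ F N (theta13LiveOfFamily F N ε₀ ζ Rz (ZtOfRecord F N)) p) 0 Set.univ (pairCfg (V := FluctV N) V1 Uf) *
        Real.exp ((sect2ActionDataOfRecord F N (FluctV N) p.K (settingOfRecord₁₃ F N (theta13LiveOfFamily F N ε₀ ζ Rz (ZtOfRecord F N)) p)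
          ((theta13LiveOfFamily F N ε₀ ζ Rz (ZtOfRecord F N)).Rz p.K) s t (fun _ => ∅, fun j => (pairCfg (V := FluctV N) V1 Uf j).2) Ek).action23 1 Uf)))
    (hC : ∀ (V1 : GaugeField (F.P p.K) 1 (SU N)) (Uf : GaugeField (F.P p.K) 0 (SU N)),
      |((Nat.card (Set (Site (F.P p.K) 0)) : ℝ))⁻¹ *
          chiRegW F N (FluctV N) (theta13LiveOfFamily F N ε₀ ζ Rz (ZtOfRecord F N)).ν (theta13LiveOfFamily F N ε₀ ζ Rz (ZtOfRecord F N)).s2.cR p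
            (gOfRecord₁₃ F N (theta13LiveOfFamily F N ε₀ ζ Rz (ZtOfRecord F N)) p) 0 Set.univ (pairCfg (V := FluctV N) V1 Uf) *
        Real.exp ((sect2ActionDataOfRecord F N (FluctV N) p.K (settingOfRecord₁₃ F N (theta13LiveOfFamily F N ε₀ ζ Rz (ZtOfRecord F N)) p)
          ((theta13LiveOfFamily F N ε₀ ζ Rz (ZtOfRecord F N)).Rz p.K) s t (fun _ => ∅, fun j => (pairCfg (V := FluctV N) V1 Uf j).2) Ek).action23 1 Uf)| ≤ C) :
    slotsTOfRecord F N (theta13LiveOfFamily F N ε₀ ζ Rz (ZtOfRecord F N)).ν (theta13LiveOfFamily F N ε₀ ζ Rz (ZtOfRecord F N)).τ9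
        (EOfRecord₁₃ F N (theta13LiveOfFamily F N ε₀ ζ Rz (ZtOfRecord F N)))
        (wOfRecord₉ F N (theta13LiveOfFamily F N ε₀ ζ Rz (ZtOfRecord F N)).toStage9Params)
        (theta13LiveOfFamily F N ε₀ ζ Rz (ZtOfRecord F N)).ppSel p
        (gOfRecord₁₃ F N (theta13LiveOfFamily F N ε₀ ζ Rz (ZtOfRecord F N)) p) 1 s = 0 ∨
      (fun V1 => transportOfRecord F N p.K 0 (fun U =>
          wOfRecord₉ F N (theta13LiveOfFamily F N ε₀ ζ Rz (ZtOfRecord F N)).toStage9Params p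
              (gOfRecord₁₃ F N (theta13LiveOfFamily F N ε₀ ζ Rz (ZtOfRecord F N)) p) 0 s U V1 *
            rhoZeroOfRecord F N p.K (gOfRecord₁₃ F N (theta13LiveOfFamily F N ε₀ ζ Rz (ZtOfRecord F N)) p 0)
              (EOfRecord₁₃ F N (theta13LiveOfFamily F N ε₀ ζ Rz (ZtOfRecord F N)) p) U) V1)
        =ᵐ[fieldMeasure (F.P p.K) 1 (SU N)]
      fun V1 => transportOfRecord F N p.K 0 (fun Uf =>
          ((Nat.card (Set (Site (F.P p.K) 0)) : ℝ))⁻¹ *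
              chiRegW F N (FluctV N) (theta13LiveOfFamily F N ε₀ ζ Rz (ZtOfRecord F N)).ν (theta13LiveOfFamily F N ε₀ ζ Rz (ZtOfRecord F N)).s2.cR p
                (gOfRecord₁₃ F N (theta13LiveOfFamily F N ε₀ ζ Rz (ZtOfRecord F N)) p) 0 Set.univ (pairCfg (V := FluctV N) V1 Uf) *
            Real.exp ((sect2ActionDataOfRecord F N (FluctV N) p.K (settingOfRecord₁₃ F N (theta13LiveOfFamily F N ε₀ ζ Rz (ZtOfRecord F N)) p)
              ((theta13LiveOfFamily F N ε₀ ζ Rz (ZtOfRecord F N)).Rz p.K) s t (fun _ => ∅, fun j => (pairCfg (V := FluctV N) V1 Uf j).2) Ek).action23 1 Uf))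
          V1 :=
  tLaw₁₃_zero_coherence_of_Zt_eq_ZtOfRecord _ p (Zt_theta13LiveOfFamily F N ε₀ ζ Rz (ZtOfRecord F N))
    (lettersJunction_theta13LiveOfFamily F N ε₀ ζ Rz (ZtOfRecord F N) p hg) hK s hΩ t Ek hcl hm hC

/-- **AT THE WITNESS OF RECORD `theta13LiveOfRecord`** (`ε₀ := 1`, K0b's `ζ`, `Rz`, `Zt` of record; runs with `0 ≤ g₀`): the no-expansion integrand at the
all-large-field sequence is `(#{Y})⁻¹ · χreg_0(T)(U,V₁) · e^{A_1(s′)(U)}`. [cite: Balaban1988Convergent, (2.10) p.256, (2.18) p.257, (2.21)–(2.23) p.258, (3.16) p.268] -/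
theorem noExpIntegrand_theta13LiveOfRecord (p : B12.RunParams) (hg : 0 ≤ p.g0)
    (s : SeqOfRecord F (theta13LiveOfRecord F N).ν (theta13LiveOfRecord F N).τ9.M (gOfRecord₁₃ F N (theta13LiveOfRecord F N) p) p.K 1)
    (hΩ : s.Ω 1 = ∅) (t : Sect2.TermValues (F.P p.K) (MatA N) (FluctV N) (theta13LiveOfRecord F N).τ9.M) (Ek : ℝ)
    (V1 : GaugeField (F.P p.K) 1 (SU N)) (Uf : GaugeField (F.P p.K) 0 (SU N)) :
    noExpIntegrand F N (FluctV N) p.K (WtOfRecord₁₃ F N (theta13LiveOfRecord F N) p)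
        (sect2Operand F N (FluctV N) p.K (settingOfRecord₁₃ F N (theta13LiveOfRecord F N) p) ((theta13LiveOfRecord F N).Rz p.K) s t Ek
          (UbgOfRecord₁₃ F N (theta13LiveOfRecord F N) p 1 s)) V1 Uf =
      ((Nat.card (Set (Site (F.P p.K) 0)) : ℝ))⁻¹ *
          chiRegW F N (FluctV N) (theta13LiveOfRecord F N).ν (theta13LiveOfRecord F N).s2.cR p
            (gOfRecord₁₃ F N (theta13LiveOfRecord F N) p) 0 Set.univ (pairCfg (V := FluctV N) V1 Uf) *
        Real.exp ((sect2ActionDataOfRecord F N (FluctV N) p.K (settingOfRecord₁₃ F N (theta13LiveOfRecord F N) p)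
          ((theta13LiveOfRecord F N).Rz p.K) s t (fun _ => ∅, fun j => (pairCfg (V := FluctV N) V1 Uf j).2) Ek).action23 1 Uf) :=
  noExpIntegrand_theta13LiveOfFamily F N eps0OfRecord₁₃ _ _ p hg s hΩ t Ek V1 Uf

/-- **THE LEVEL-1 COHERENCE EQUATION AT THE WITNESS OF RECORD, CLOSED FORM** — what the rev-16 K1‴ stub `stub_nodes13` would owe node N11 AT K0a's `theta13LiveOfRecord`
first of all (the `k = 0` instance of (S1ᵀ)₁₃ at the all-large-field new sequence; `0 ≤ g₀`, `0 < K`): `slotT_1(s′) ≡ 0` or, `dV₁`-a.e.,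
`∫dU δ(ŪV₁⁻¹) w(s′)(U,V₁)·ρ₀(U) = (#{Y})⁻¹ ∫dU δ(ŪV₁⁻¹) 𝟙{U cR·ε₀-regular}·e^{A_1(s′)(U)}`.  A READING, displayed hypotheses; nothing of Bałaban asserted.
[cite: Balaban1988Convergent, Theorem p.245, (3.1)–(3.2) pp.264–265, (3.25) p.270, (2.10) p.256, (2.21)–(2.23) p.258] -/
theorem tLaw₁₃_zero_coherence_theta13LiveOfRecord (p : B12.RunParams) (hg : 0 ≤ p.g0) (hK : 0 < p.K)
    (s : SeqOfRecord F (theta13LiveOfRecord F N).ν (theta13LiveOfRecord F N).τ9.M (gOfRecord₁₃ F N (theta13LiveOfRecord F N) p) p.K 1)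
    (hΩ : s.Ω 1 = ∅) (t : Sect2.TermValues (F.P p.K) (MatA N) (FluctV N) (theta13LiveOfRecord F N).τ9.M) (Ek : ℝ)
    (hcl : slotsTOfRecord F N (theta13LiveOfRecord F N).ν (theta13LiveOfRecord F N).τ9 (EOfRecord₁₃ F N (theta13LiveOfRecord F N))
          (wOfRecord₉ F N (theta13LiveOfRecord F N).toStage9Params) (theta13LiveOfRecord F N).ppSel p
          (gOfRecord₁₃ F N (theta13LiveOfRecord F N) p) 1 s = 0 ∨
        ∀ᵐ V1 ∂fieldMeasure (F.P p.K) 1 (SU N),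
          slotsTOfRecord F N (theta13LiveOfRecord F N).ν (theta13LiveOfRecord F N).τ9 (EOfRecord₁₃ F N (theta13LiveOfRecord F N))
              (wOfRecord₉ F N (theta13LiveOfRecord F N).toStage9Params) (theta13LiveOfRecord F N).ppSel p
              (gOfRecord₁₃ F N (theta13LiveOfRecord F N) p) 1 s V1 =
            sect2Slot F N (FluctV N) p.K (settingOfRecord₁₃ F N (theta13LiveOfRecord F N) p) ((theta13LiveOfRecord F N).Rz p.K)
              (WtOfRecord₁₃ F N (theta13LiveOfRecord F N) p) s t Ek (UbgOfRecord₁₃ F N (theta13LiveOfRecord F N) p 1 s) V1)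
    {C : ℝ}
    (hm : Measurable (Function.uncurry fun (V1 : GaugeField (F.P p.K) 1 (SU N)) (Uf : GaugeField (F.P p.K) 0 (SU N)) =>
      ((Nat.card (Set (Site (F.P p.K) 0)) : ℝ))⁻¹ *
          chiRegW F N (FluctV N) (theta13LiveOfRecord F N).ν (theta13LiveOfRecord F N).s2.cR p
            (gOfRecord₁₃ F N (theta13LiveOfRecord F N) p) 0 Set.univ (pairCfg (V := FluctV N) V1 Uf) *
        Real.exp ((sect2ActionDataOfRecord F N (FluctV N) p.K (settingOfRecord₁₃ F N (theta13LiveOfRecord F N) p)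
          ((theta13LiveOfRecord F N).Rz p.K) s t (fun _ => ∅, fun j => (pairCfg (V := FluctV N) V1 Uf j).2) Ek).action23 1 Uf)))
    (hC : ∀ (V1 : GaugeField (F.P p.K) 1 (SU N)) (Uf : GaugeField (F.P p.K) 0 (SU N)),
      |((Nat.card (Set (Site (F.P p.K) 0)) : ℝ))⁻¹ *
          chiRegW F N (FluctV N) (theta13LiveOfRecord F N).ν (theta13LiveOfRecord F N).s2.cR p
            (gOfRecord₁₃ F N (theta13LiveOfRecord F N) p) 0 Set.univ (pairCfg (V := FluctV N) V1 Uf) *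
        Real.exp ((sect2ActionDataOfRecord F N (FluctV N) p.K (settingOfRecord₁₃ F N (theta13LiveOfRecord F N) p)
          ((theta13LiveOfRecord F N).Rz p.K) s t (fun _ => ∅, fun j => (pairCfg (V := FluctV N) V1 Uf j).2) Ek).action23 1 Uf)| ≤ C) :
    slotsTOfRecord F N (theta13LiveOfRecord F N).ν (theta13LiveOfRecord F N).τ9 (EOfRecord₁₃ F N (theta13LiveOfRecord F N))
        (wOfRecord₉ F N (theta13LiveOfRecord F N).toStage9Params) (theta13LiveOfRecord F N).ppSel p
        (gOfRecord₁₃ F N (theta13LiveOfRecord F N) p) 1 s = 0 ∨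
      (fun V1 => transportOfRecord F N p.K 0 (fun U =>
          wOfRecord₉ F N (theta13LiveOfRecord F N).toStage9Params p (gOfRecord₁₃ F N (theta13LiveOfRecord F N) p) 0 s U V1 *
            rhoZeroOfRecord F N p.K (gOfRecord₁₃ F N (theta13LiveOfRecord F N) p 0) (EOfRecord₁₃ F N (theta13LiveOfRecord F N) p) U) V1)
        =ᵐ[fieldMeasure (F.P p.K) 1 (SU N)]
      fun V1 => transportOfRecord F N p.K 0 (fun Uf =>
          ((Nat.card (Set (Site (F.P p.K) 0)) : ℝ))⁻¹ *
              chiRegW F N (FluctV N) (theta13LiveOfRecord F N).ν (theta13LiveOfRecord F N).s2.cR p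
                (gOfRecord₁₃ F N (theta13LiveOfRecord F N) p) 0 Set.univ (pairCfg (V := FluctV N) V1 Uf) *
            Real.exp ((sect2ActionDataOfRecord F N (FluctV N) p.K (settingOfRecord₁₃ F N (theta13LiveOfRecord F N) p)
              ((theta13LiveOfRecord F N).Rz p.K) s t (fun _ => ∅, fun j => (pairCfg (V := FluctV N) V1 Uf j).2) Ek).action23 1 Uf)) V1 :=
  tLaw₁₃_zero_coherence_theta13LiveOfFamily F N eps0OfRecord₁₃ _ _ p hg hK s hΩ t Ek hcl hm hC

end AtWitness

/-! ## §4  AT K0a's FILE-9 FAMILIES: both small-field letters open (`theta13LiveOfFamily₂`), and EVERY numeric letter open (`theta13LiveOfNumerics`, junction displayed) -/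

section AtFamily2

variable (F : T4Family) (N : ℕ) [NeZero N]
variable (ε₀ ε₂₉ : ℝ) (ζ : ZetaOfRecord F N (numerics7OfFamily ε₀) 1) (Rz : (K : ℕ) → Sect2.Residual (F.P K) (MatA N))
  (Zt : (K : ℕ) → TkResidualW F N (FluctV N) K)

/-- K0a's two-letter witness carries its residual 𝐓-weight ARGUMENT (`rfl`). [cite: Balaban1988Convergent, (2.21) p.258 (bookkeeping witness)] -/
theorem Zt_theta13LiveOfFamily₂ : (theta13LiveOfFamily₂ F N ε₀ ε₂₉ ζ Rz Zt).Zt = Zt := rfl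

/-- **THE JUNCTION AT THE TWO-LETTER WITNESS** (every `ε₀`, `ε₂₉`; runs with `0 ≤ g₀`): its numerics are the family's (`numerics7OfFamily ε₀`, `sect2NumericsOfFamily`).
[cite: Balaban1988Convergent, (2.4) p.255, (2.10) p.256, (2.12) p.256] -/
theorem lettersJunction_theta13LiveOfFamily₂ (p : B12.RunParams) (hg : 0 ≤ p.g0) :
    (theta13LiveOfFamily₂ F N ε₀ ε₂₉ ζ Rz Zt).s2.cR *
        epsOfRecord (theta13LiveOfFamily₂ F N ε₀ ε₂₉ ζ Rz Zt).ν (gOfRecord₁₃ F N (theta13LiveOfFamily₂ F N ε₀ ε₂₉ ζ Rz Zt) p) 0 ≤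
      (theta13LiveOfFamily₂ F N ε₀ ε₂₉ ζ Rz Zt).ν.εreg * (F.P p.K).eta 0 ^ 2 := by
  have h0 : gOfRecord₁₃ F N (theta13LiveOfFamily₂ F N ε₀ ε₂₉ ζ Rz Zt) p 0 = p.g0 := FlowStepRuns.genSeq_zero _ _
  exact lettersJunction_numericsOfFamily F ε₀ p.K (gOfRecord₁₃ F N (theta13LiveOfFamily₂ F N ε₀ ε₂₉ ζ Rz Zt) p) (by rw [h0]; exact hg)

/-- **THE LEVEL-1 COHERENCE EQUATION AT K0a's TWO-LETTER WITNESS `theta13LiveOfFamily₂ ε₀ ε₂₉ ζ Rz ZtOfRecord`, CLOSED FORM** (every `ε₀`, `ε₂₉`, `ζ`, `Rz`; `0 ≤ g₀`,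
`0 < K`; junction discharged) — the term the (D4) ∕ N26 ∕ N1-small ₁₃ consumers instantiate at reads, for N11's first (S1ᵀ)₁₃ instance at the all-large-field sequence,
`slotT_1(s′) ≡ 0` or `T[w(s′)ρ₀] =ᵐ T[(#{Y})⁻¹·χreg_0(T)·e^{A_1(s′)}]`. [cite: Balaban1988Convergent, Theorem p.245, (3.1)–(3.2) pp.264–265, (3.25) p.270, (2.10) p.256, (2.21)–(2.23) p.258] -/
theorem tLaw₁₃_zero_coherence_theta13LiveOfFamily₂ (p : B12.RunParams) (hg : 0 ≤ p.g0) (hK : 0 < p.K)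
    (s : SeqOfRecord F (theta13LiveOfFamily₂ F N ε₀ ε₂₉ ζ Rz (ZtOfRecord F N)).ν (theta13LiveOfFamily₂ F N ε₀ ε₂₉ ζ Rz (ZtOfRecord F N)).τ9.M
      (gOfRecord₁₃ F N (theta13LiveOfFamily₂ F N ε₀ ε₂₉ ζ Rz (ZtOfRecord F N)) p) p.K 1) (hΩ : s.Ω 1 = ∅)
    (t : Sect2.TermValues (F.P p.K) (MatA N) (FluctV N) (theta13LiveOfFamily₂ F N ε₀ ε₂₉ ζ Rz (ZtOfRecord F N)).τ9.M) (Ek : ℝ)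
    (hcl : slotsTOfRecord F N (theta13LiveOfFamily₂ F N ε₀ ε₂₉ ζ Rz (ZtOfRecord F N)).ν (theta13LiveOfFamily₂ F N ε₀ ε₂₉ ζ Rz (ZtOfRecord F N)).τ9
          (EOfRecord₁₃ F N (theta13LiveOfFamily₂ F N ε₀ ε₂₉ ζ Rz (ZtOfRecord F N)))
          (wOfRecord₉ F N (theta13LiveOfFamily₂ F N ε₀ ε₂₉ ζ Rz (ZtOfRecord F N)).toStage9Params)
          (theta13LiveOfFamily₂ F N ε₀ ε₂₉ ζ Rz (ZtOfRecord F N)).ppSel p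
          (gOfRecord₁₃ F N (theta13LiveOfFamily₂ F N ε₀ ε₂₉ ζ Rz (ZtOfRecord F N)) p) 1 s = 0 ∨
        ∀ᵐ V1 ∂fieldMeasure (F.P p.K) 1 (SU N),
          slotsTOfRecord F N (theta13LiveOfFamily₂ F N ε₀ ε₂₉ ζ Rz (ZtOfRecord F N)).ν (theta13LiveOfFamily₂ F N ε₀ ε₂₉ ζ Rz (ZtOfRecord F N)).τ9
              (EOfRecord₁₃ F N (theta13LiveOfFamily₂ F N ε₀ ε₂₉ ζ Rz (ZtOfRecord F N)))
              (wOfRecord₉ F N (theta13LiveOfFamily₂ F N ε₀ ε₂₉ ζ Rz (ZtOfRecord F N)).toStage9Params)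
              (theta13LiveOfFamily₂ F N ε₀ ε₂₉ ζ Rz (ZtOfRecord F N)).ppSel p
              (gOfRecord₁₃ F N (theta13LiveOfFamily₂ F N ε₀ ε₂₉ ζ Rz (ZtOfRecord F N)) p) 1 s V1 =
            sect2Slot F N (FluctV N) p.K (settingOfRecord₁₃ F N (theta13LiveOfFamily₂ F N ε₀ ε₂₉ ζ Rz (ZtOfRecord F N)) p)
              ((theta13LiveOfFamily₂ F N ε₀ ε₂₉ ζ Rz (ZtOfRecord F N)).Rz p.K)
              (WtOfRecord₁₃ F N (theta13LiveOfFamily₂ F N ε₀ ε₂₉ ζ Rz (ZtOfRecord F N)) p) s t Ek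
              (UbgOfRecord₁₃ F N (theta13LiveOfFamily₂ F N ε₀ ε₂₉ ζ Rz (ZtOfRecord F N)) p 1 s) V1)
    {C : ℝ}
    (hm : Measurable (Function.uncurry fun (V1 : GaugeField (F.P p.K) 1 (SU N)) (Uf : GaugeField (F.P p.K) 0 (SU N)) =>
      ((Nat.card (Set (Site (F.P p.K) 0)) : ℝ))⁻¹ *
          chiRegW F N (FluctV N) (theta13LiveOfFamily₂ F N ε₀ ε₂₉ ζ Rz (ZtOfRecord F N)).ν (theta13LiveOfFamily₂ F N ε₀ ε₂₉ ζ Rz (ZtOfRecord F N)).s2.cR p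
            (gOfRecord₁₃ F N (theta13LiveOfFamily₂ F N ε₀ ε₂₉ ζ Rz (ZtOfRecord F N)) p) 0 Set.univ (pairCfg (V := FluctV N) V1 Uf) *
        Real.exp ((sect2ActionDataOfRecord F N (FluctV N) p.K (settingOfRecord₁₃ F N (theta13LiveOfFamily₂ F N ε₀ ε₂₉ ζ Rz (ZtOfRecord F N)) p)
          ((theta13LiveOfFamily₂ F N ε₀ ε₂₉ ζ Rz (ZtOfRecord F N)).Rz p.K) s t (fun _ => ∅, fun j => (pairCfg (V := FluctV N) V1 Uf j).2) Ek).action23 1 Uf)))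
    (hC : ∀ (V1 : GaugeField (F.P p.K) 1 (SU N)) (Uf : GaugeField (F.P p.K) 0 (SU N)),
      |((Nat.card (Set (Site (F.P p.K) 0)) : ℝ))⁻¹ *
          chiRegW F N (FluctV N) (theta13LiveOfFamily₂ F N ε₀ ε₂₉ ζ Rz (ZtOfRecord F N)).ν (theta13LiveOfFamily₂ F N ε₀ ε₂₉ ζ Rz (ZtOfRecord F N)).s2.cR p
            (gOfRecord₁₃ F N (theta13LiveOfFamily₂ F N ε₀ ε₂₉ ζ Rz (ZtOfRecord F N)) p) 0 Set.univ (pairCfg (V := FluctV N) V1 Uf) *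
        Real.exp ((sect2ActionDataOfRecord F N (FluctV N) p.K (settingOfRecord₁₃ F N (theta13LiveOfFamily₂ F N ε₀ ε₂₉ ζ Rz (ZtOfRecord F N)) p)
          ((theta13LiveOfFamily₂ F N ε₀ ε₂₉ ζ Rz (ZtOfRecord F N)).Rz p.K) s t (fun _ => ∅, fun j => (pairCfg (V := FluctV N) V1 Uf j).2) Ek).action23 1 Uf)| ≤ C) :
    slotsTOfRecord F N (theta13LiveOfFamily₂ F N ε₀ ε₂₉ ζ Rz (ZtOfRecord F N)).ν (theta13LiveOfFamily₂ F N ε₀ ε₂₉ ζ Rz (ZtOfRecord F N)).τ9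
        (EOfRecord₁₃ F N (theta13LiveOfFamily₂ F N ε₀ ε₂₉ ζ Rz (ZtOfRecord F N)))
        (wOfRecord₉ F N (theta13LiveOfFamily₂ F N ε₀ ε₂₉ ζ Rz (ZtOfRecord F N)).toStage9Params)
        (theta13LiveOfFamily₂ F N ε₀ ε₂₉ ζ Rz (ZtOfRecord F N)).ppSel p
        (gOfRecord₁₃ F N (theta13LiveOfFamily₂ F N ε₀ ε₂₉ ζ Rz (ZtOfRecord F N)) p) 1 s = 0 ∨
      (fun V1 => transportOfRecord F N p.K 0 (fun U =>
          wOfRecord₉ F N (theta13LiveOfFamily₂ F N ε₀ ε₂₉ ζ Rz (ZtOfRecord F N)).toStage9Params p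
              (gOfRecord₁₃ F N (theta13LiveOfFamily₂ F N ε₀ ε₂₉ ζ Rz (ZtOfRecord F N)) p) 0 s U V1 *
            rhoZeroOfRecord F N p.K (gOfRecord₁₃ F N (theta13LiveOfFamily₂ F N ε₀ ε₂₉ ζ Rz (ZtOfRecord F N)) p 0)
              (EOfRecord₁₃ F N (theta13LiveOfFamily₂ F N ε₀ ε₂₉ ζ Rz (ZtOfRecord F N)) p) U) V1)
        =ᵐ[fieldMeasure (F.P p.K) 1 (SU N)]
      fun V1 => transportOfRecord F N p.K 0 (fun Uf =>
          ((Nat.card (Set (Site (F.P p.K) 0)) : ℝ))⁻¹ *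
              chiRegW F N (FluctV N) (theta13LiveOfFamily₂ F N ε₀ ε₂₉ ζ Rz (ZtOfRecord F N)).ν (theta13LiveOfFamily₂ F N ε₀ ε₂₉ ζ Rz (ZtOfRecord F N)).s2.cR p
                (gOfRecord₁₃ F N (theta13LiveOfFamily₂ F N ε₀ ε₂₉ ζ Rz (ZtOfRecord F N)) p) 0 Set.univ (pairCfg (V := FluctV N) V1 Uf) *
            Real.exp ((sect2ActionDataOfRecord F N (FluctV N) p.K (settingOfRecord₁₃ F N (theta13LiveOfFamily₂ F N ε₀ ε₂₉ ζ Rz (ZtOfRecord F N)) p)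
              ((theta13LiveOfFamily₂ F N ε₀ ε₂₉ ζ Rz (ZtOfRecord F N)).Rz p.K) s t (fun _ => ∅, fun j => (pairCfg (V := FluctV N) V1 Uf j).2) Ek).action23 1 Uf))
          V1 :=
  tLaw₁₃_zero_coherence_of_Zt_eq_ZtOfRecord _ p (Zt_theta13LiveOfFamily₂ F N ε₀ ε₂₉ ζ Rz (ZtOfRecord F N))
    (lettersJunction_theta13LiveOfFamily₂ F N ε₀ ε₂₉ ζ Rz (ZtOfRecord F N) p hg) hK s hΩ t Ek hcl hm hC

end AtFamily2

section AtNumerics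

variable (F : T4Family) (N : ℕ) [NeZero N]
variable (n : Stage12Numerics) (ε₂₉ : ℝ) (ζ : ZetaOfRecord F N n.ν n.τ9.M) (Rz : (K : ℕ) → Sect2.Residual (F.P K) (MatA N))
  (Zt : (K : ℕ) → TkResidualW F N (FluctV N) K)

/-- K0a's all-numerics witness carries its residual 𝐓-weight ARGUMENT (`rfl`). [cite: Balaban1988Convergent, (2.21) p.258 (bookkeeping witness)] -/
theorem Zt_theta13LiveOfNumerics : (theta13LiveOfNumerics F N n ε₂₉ ζ Rz Zt).Zt = Zt := rfl

/-- **THE LEVEL-1 COHERENCE EQUATION AT K0a's ALL-NUMERICS WITNESS `theta13LiveOfNumerics n ε₂₉ ζ Rz ZtOfRecord`, CLOSED FORM** — every numeric letter of `n` open, so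
the letters' junction `n.s2.cR·ε₀(g₀) ≤ n.ν.εreg·η₀²` along the run is A DISPLAYED NUMERICS CONDITION (`hc`; at a re-pin keyed to [15]'s constants it reads
`cR·A₀·g₀·(log g₀⁻²)^{p₀} ≤ εreg`): `slotT_1(s′) ≡ 0` or `T[w(s′)ρ₀] =ᵐ T[(#{Y})⁻¹·χreg_0(T)·e^{A_1(s′)}]` (`0 < K`).
[cite: Balaban1988Convergent, Theorem p.245, (3.1)–(3.2) pp.264–265, (3.25) p.270, (2.4) p.255, (2.10) p.256, (2.21)–(2.23) p.258] -/
theorem tLaw₁₃_zero_coherence_theta13LiveOfNumerics (p : B12.RunParams) (hK : 0 < p.K)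
    (hc : (theta13LiveOfNumerics F N n ε₂₉ ζ Rz (ZtOfRecord F N)).s2.cR *
        epsOfRecord (theta13LiveOfNumerics F N n ε₂₉ ζ Rz (ZtOfRecord F N)).ν (gOfRecord₁₃ F N (theta13LiveOfNumerics F N n ε₂₉ ζ Rz (ZtOfRecord F N)) p) 0 ≤
      (theta13LiveOfNumerics F N n ε₂₉ ζ Rz (ZtOfRecord F N)).ν.εreg * (F.P p.K).eta 0 ^ 2)
    (s : SeqOfRecord F (theta13LiveOfNumerics F N n ε₂₉ ζ Rz (ZtOfRecord F N)).ν (theta13LiveOfNumerics F N n ε₂₉ ζ Rz (ZtOfRecord F N)).τ9.M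
      (gOfRecord₁₃ F N (theta13LiveOfNumerics F N n ε₂₉ ζ Rz (ZtOfRecord F N)) p) p.K 1) (hΩ : s.Ω 1 = ∅)
    (t : Sect2.TermValues (F.P p.K) (MatA N) (FluctV N) (theta13LiveOfNumerics F N n ε₂₉ ζ Rz (ZtOfRecord F N)).τ9.M) (Ek : ℝ)
    (hcl : slotsTOfRecord F N (theta13LiveOfNumerics F N n ε₂₉ ζ Rz (ZtOfRecord F N)).ν (theta13LiveOfNumerics F N n ε₂₉ ζ Rz (ZtOfRecord F N)).τ9
          (EOfRecord₁₃ F N (theta13LiveOfNumerics F N n ε₂₉ ζ Rz (ZtOfRecord F N)))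
          (wOfRecord₉ F N (theta13LiveOfNumerics F N n ε₂₉ ζ Rz (ZtOfRecord F N)).toStage9Params)
          (theta13LiveOfNumerics F N n ε₂₉ ζ Rz (ZtOfRecord F N)).ppSel p
          (gOfRecord₁₃ F N (theta13LiveOfNumerics F N n ε₂₉ ζ Rz (ZtOfRecord F N)) p) 1 s = 0 ∨
        ∀ᵐ V1 ∂fieldMeasure (F.P p.K) 1 (SU N),
          slotsTOfRecord F N (theta13LiveOfNumerics F N n ε₂₉ ζ Rz (ZtOfRecord F N)).ν (theta13LiveOfNumerics F N n ε₂₉ ζ Rz (ZtOfRecord F N)).τ9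
              (EOfRecord₁₃ F N (theta13LiveOfNumerics F N n ε₂₉ ζ Rz (ZtOfRecord F N)))
              (wOfRecord₉ F N (theta13LiveOfNumerics F N n ε₂₉ ζ Rz (ZtOfRecord F N)).toStage9Params)
              (theta13LiveOfNumerics F N n ε₂₉ ζ Rz (ZtOfRecord F N)).ppSel p
              (gOfRecord₁₃ F N (theta13LiveOfNumerics F N n ε₂₉ ζ Rz (ZtOfRecord F N)) p) 1 s V1 =
            sect2Slot F N (FluctV N) p.K (settingOfRecord₁₃ F N (theta13LiveOfNumerics F N n ε₂₉ ζ Rz (ZtOfRecord F N)) p)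
              ((theta13LiveOfNumerics F N n ε₂₉ ζ Rz (ZtOfRecord F N)).Rz p.K)
              (WtOfRecord₁₃ F N (theta13LiveOfNumerics F N n ε₂₉ ζ Rz (ZtOfRecord F N)) p) s t Ek
              (UbgOfRecord₁₃ F N (theta13LiveOfNumerics F N n ε₂₉ ζ Rz (ZtOfRecord F N)) p 1 s) V1)
    {C : ℝ}
    (hm : Measurable (Function.uncurry fun (V1 : GaugeField (F.P p.K) 1 (SU N)) (Uf : GaugeField (F.P p.K) 0 (SU N)) =>
      ((Nat.card (Set (Site (F.P p.K) 0)) : ℝ))⁻¹ *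
          chiRegW F N (FluctV N) (theta13LiveOfNumerics F N n ε₂₉ ζ Rz (ZtOfRecord F N)).ν (theta13LiveOfNumerics F N n ε₂₉ ζ Rz (ZtOfRecord F N)).s2.cR p
            (gOfRecord₁₃ F N (theta13LiveOfNumerics F N n ε₂₉ ζ Rz (ZtOfRecord F N)) p) 0 Set.univ (pairCfg (V := FluctV N) V1 Uf) *
        Real.exp ((sect2ActionDataOfRecord F N (FluctV N) p.K (settingOfRecord₁₃ F N (theta13LiveOfNumerics F N n ε₂₉ ζ Rz (ZtOfRecord F N)) p)
          ((theta13LiveOfNumerics F N n ε₂₉ ζ Rz (ZtOfRecord F N)).Rz p.K) s t (fun _ => ∅, fun j => (pairCfg (V := FluctV N) V1 Uf j).2) Ek).action23 1 Uf)))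
    (hC : ∀ (V1 : GaugeField (F.P p.K) 1 (SU N)) (Uf : GaugeField (F.P p.K) 0 (SU N)),
      |((Nat.card (Set (Site (F.P p.K) 0)) : ℝ))⁻¹ *
          chiRegW F N (FluctV N) (theta13LiveOfNumerics F N n ε₂₉ ζ Rz (ZtOfRecord F N)).ν (theta13LiveOfNumerics F N n ε₂₉ ζ Rz (ZtOfRecord F N)).s2.cR p
            (gOfRecord₁₃ F N (theta13LiveOfNumerics F N n ε₂₉ ζ Rz (ZtOfRecord F N)) p) 0 Set.univ (pairCfg (V := FluctV N) V1 Uf) *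
        Real.exp ((sect2ActionDataOfRecord F N (FluctV N) p.K (settingOfRecord₁₃ F N (theta13LiveOfNumerics F N n ε₂₉ ζ Rz (ZtOfRecord F N)) p)
          ((theta13LiveOfNumerics F N n ε₂₉ ζ Rz (ZtOfRecord F N)).Rz p.K) s t (fun _ => ∅, fun j => (pairCfg (V := FluctV N) V1 Uf j).2) Ek).action23 1 Uf)| ≤ C) :
    slotsTOfRecord F N (theta13LiveOfNumerics F N n ε₂₉ ζ Rz (ZtOfRecord F N)).ν (theta13LiveOfNumerics F N n ε₂₉ ζ Rz (ZtOfRecord F N)).τ9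
        (EOfRecord₁₃ F N (theta13LiveOfNumerics F N n ε₂₉ ζ Rz (ZtOfRecord F N)))
        (wOfRecord₉ F N (theta13LiveOfNumerics F N n ε₂₉ ζ Rz (ZtOfRecord F N)).toStage9Params)
        (theta13LiveOfNumerics F N n ε₂₉ ζ Rz (ZtOfRecord F N)).ppSel p
        (gOfRecord₁₃ F N (theta13LiveOfNumerics F N n ε₂₉ ζ Rz (ZtOfRecord F N)) p) 1 s = 0 ∨
      (fun V1 => transportOfRecord F N p.K 0 (fun U =>
          wOfRecord₉ F N (theta13LiveOfNumerics F N n ε₂₉ ζ Rz (ZtOfRecord F N)).toStage9Params p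
              (gOfRecord₁₃ F N (theta13LiveOfNumerics F N n ε₂₉ ζ Rz (ZtOfRecord F N)) p) 0 s U V1 *
            rhoZeroOfRecord F N p.K (gOfRecord₁₃ F N (theta13LiveOfNumerics F N n ε₂₉ ζ Rz (ZtOfRecord F N)) p 0)
              (EOfRecord₁₃ F N (theta13LiveOfNumerics F N n ε₂₉ ζ Rz (ZtOfRecord F N)) p) U) V1)
        =ᵐ[fieldMeasure (F.P p.K) 1 (SU N)]
      fun V1 => transportOfRecord F N p.K 0 (fun Uf =>
          ((Nat.card (Set (Site (F.P p.K) 0)) : ℝ))⁻¹ *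
              chiRegW F N (FluctV N) (theta13LiveOfNumerics F N n ε₂₉ ζ Rz (ZtOfRecord F N)).ν (theta13LiveOfNumerics F N n ε₂₉ ζ Rz (ZtOfRecord F N)).s2.cR p
                (gOfRecord₁₃ F N (theta13LiveOfNumerics F N n ε₂₉ ζ Rz (ZtOfRecord F N)) p) 0 Set.univ (pairCfg (V := FluctV N) V1 Uf) *
            Real.exp ((sect2ActionDataOfRecord F N (FluctV N) p.K (settingOfRecord₁₃ F N (theta13LiveOfNumerics F N n ε₂₉ ζ Rz (ZtOfRecord F N)) p)
              ((theta13LiveOfNumerics F N n ε₂₉ ζ Rz (ZtOfRecord F N)).Rz p.K) s t (fun _ => ∅, fun j => (pairCfg (V := FluctV N) V1 Uf j).2) Ek).action23 1 Uf))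
          V1 :=
  tLaw₁₃_zero_coherence_of_Zt_eq_ZtOfRecord _ p (Zt_theta13LiveOfNumerics F N n ε₂₉ ζ Rz (ZtOfRecord F N)) hc hK s hΩ t Ek hcl hm hC

end AtNumerics

/-! ## §5 (v1.1)  EVERY LEVEL: the top-generation no-expansion integrand at a `θ` with `θ.Zt = ZtOfRecord` in closed form, and the level-(k+1) coherence equation -/

section EveryLevel

variable {F : T4Family} {N : ℕ} [NeZero N]
variable (θ : Stage13Params F N) (p : B12.RunParams)

/-- **THE TOP-GENERATION NO-EXPANSION INTEGRAND AT LEVEL `k`, CLOSED FORM** (any `θ` with `θ.Zt = ZtOfRecord`, any old-branch function `Ψ`, NO junction needed):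
`noExpIntegrandAt k (WtOfRecord₁₃ θ p) Ψ V′ U = (#{Y ⊂ T})⁻¹ · χreg_k(T)(U,V′) · Ψ(U,V′)` at the two-scale configuration — K0b's residual factor is the constant
`(#{Y})⁻¹` at every generation and its unit-covariance placeholder vanishes at the empty domain (`ZtOfRecord_ζ0_apply`, `ZtOfRecord_quad_empty`), 12a's
`ζ_k = ζ0·χreg` and `w_k(∅,∅,∅) = e^{−½quad_k(∅)}` (g3's `zeta_tkWeightsOfRecord_apply`, `w_tkWeightsOfRecord_empty`).
[cite: Balaban1988Convergent, (2.21)–(2.22) p.258, (2.10) p.256, (3.16) p.268, (3.24) p.270; Balaban1987RG1, (1.5) p.261] -/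
theorem noExpIntegrandAt_WtOfRecord₁₃_of_Zt_eq_ZtOfRecord (hZt : θ.Zt = ZtOfRecord F N) (k : ℕ) (Ψ : MultiCfg (F.P p.K) (SU N) (FluctV N) → ℝ)
    (V' : GaugeField (F.P p.K) (k + 1) (SU N)) (U : GaugeField (F.P p.K) k (SU N)) :
    noExpIntegrandAt F N (FluctV N) p.K k (WtOfRecord₁₃ F N θ p) Ψ V' U =
      ((Nat.card (Set (Site (F.P p.K) 0)) : ℝ))⁻¹ *
          chiRegW F N (FluctV N) θ.ν θ.s2.cR p (gOfRecord₁₃ F N θ p) k Set.univ (pairCfgAt (V := FluctV N) k V' U) *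
        Ψ (pairCfgAt (V := FluctV N) k V' U) := by
  unfold noExpIntegrandAt
  rw [WtOfRecord₁₃_eq, zeta_tkWeightsOfRecord_apply, w_tkWeightsOfRecord_empty, hZt, ZtOfRecord_ζ0_apply, ZtOfRecord_quad_empty, mul_zero,
    Real.exp_zero, one_mul]

/-- **THE LEVEL-(k+1) NO-EXPANSION COHERENCE EQUATION AT A `θ` WITH `θ.Zt = ZtOfRecord`, IN CLOSED FORM** (`k < K`, `s′` with `Ω_{k+1}(s′) = ∅`): given the §2
identity of `ρ_k`'s slot at `init s′` (witness `(t, E_k)`, identity branch) and a witness pair `(t′, E_{k+1})` of the (S1ᵀ)₁₃,ₖ dichotomy at `s′`, under the displayed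
joint measurability ∕ bound OF THE CLOSED-FORM old-branch integrands: EITHER `slotT_{k+1}(s′) ≡ 0` OR, `dV′`-a.e.,
`∫dU δ(ŪV′⁻¹) w(s′)(U,V′)·χ_k(init s′)(U)·𝐓_k(init s′)e^{A_k(init s′)}(U) = (#{Y})⁻¹ Σ_S ∫dU δ(ŪV′⁻¹) χreg_k(T)(U,V′)·[𝐓_k(init s′,S)e^{A_{k+1}(s′)}_S](U,V′)` — the left
side carries def-T's (3.2) large-field indicators of `V′`, the right side only p. 256's regularity indicator (this seat's `TkNoExpansionAtRecord13.tLaw₁₃_coherence_of_Omega_empty`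
with §5's closed form substituted). [cite: Balaban1988Convergent, Theorem p.245, (3.1)–(3.2) pp.264–265, (3.24)–(3.25) p.270, (2.18) p.257, (2.21)–(2.23) p.258] -/
theorem tLaw₁₃_coherence_of_Zt_eq_ZtOfRecord (hZt : θ.Zt = ZtOfRecord F N) {k : ℕ} (hk : k < p.K)
    (s : SeqOfRecord F θ.ν θ.τ9.M (gOfRecord₁₃ F N θ p) p.K (k + 1)) (hΩ : s.Ω (k + 1) = ∅)
    (t : Sect2.TermValues (F.P p.K) (MatA N) (FluctV N) θ.τ9.M) (Ek : ℝ)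
    (hid : ∀ᵐ U₀ ∂fieldMeasure (F.P p.K) k (SU N),
      chiSeqOfRecord F N θ.ν θ.τ9.M (gOfRecord₁₃ F N θ p) p.K k s.init U₀ ≠ 0 →
        slotsOfRecord F N θ.ν θ.τ9 (EOfRecord₁₃ F N θ) (wOfRecord₉ F N θ.toStage9Params) θ.ppSel p
            (gOfRecord₁₃ F N θ p) k s.init U₀ =
          sect2Slot F N (FluctV N) p.K (settingOfRecord₁₃ F N θ p) (θ.Rz p.K) (WtOfRecord₁₃ F N θ p) s.init t Ek
            (UbgOfRecord₁₃ F N θ p k s.init) U₀)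
    (t' : Sect2.TermValues (F.P p.K) (MatA N) (FluctV N) θ.τ9.M) (Ek' : ℝ)
    (hcl : slotsTOfRecord F N θ.ν θ.τ9 (EOfRecord₁₃ F N θ) (wOfRecord₉ F N θ.toStage9Params) θ.ppSel p
          (gOfRecord₁₃ F N θ p) (k + 1) s = 0 ∨
        ∀ᵐ V' ∂fieldMeasure (F.P p.K) (k + 1) (SU N),
          slotsTOfRecord F N θ.ν θ.τ9 (EOfRecord₁₃ F N θ) (wOfRecord₉ F N θ.toStage9Params) θ.ppSel p
              (gOfRecord₁₃ F N θ p) (k + 1) s V' =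
            sect2Slot F N (FluctV N) p.K (settingOfRecord₁₃ F N θ p) (θ.Rz p.K) (WtOfRecord₁₃ F N θ p) s t' Ek'
              (UbgOfRecord₁₃ F N θ p (k + 1) s) V')
    {C : ℝ}
    (hm : ∀ S ∈ admSOfRecord F θ.ν θ.τ9.M (gOfRecord₁₃ F N θ p) p.K k s.init,
      Measurable (Function.uncurry fun (V' : GaugeField (F.P p.K) (k + 1) (SU N)) (U₀ : GaugeField (F.P p.K) k (SU N)) =>
        ((Nat.card (Set (Site (F.P p.K) 0)) : ℝ))⁻¹ *
            chiRegW F N (FluctV N) θ.ν θ.s2.cR p (gOfRecord₁₃ F N θ p) k Set.univ (pairCfgAt (V := FluctV N) k V' U₀) *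
          tkBranchOfRecord F N (FluctV N) θ.ν θ.τ9.M _ p.K (WtOfRecord₁₃ F N θ p) s.init S k
            (fun ω => sect2Operand F N (FluctV N) p.K (settingOfRecord₁₃ F N θ p) (θ.Rz p.K) s t' Ek' (UbgOfRecord₁₃ F N θ p (k + 1) s)
              (S, fun j => (ω j).2) (fun j => (ω j).1)) (pairCfgAt (V := FluctV N) k V' U₀)))
    (hC : ∀ S ∈ admSOfRecord F θ.ν θ.τ9.M (gOfRecord₁₃ F N θ p) p.K k s.init,
      ∀ (V' : GaugeField (F.P p.K) (k + 1) (SU N)) (U₀ : GaugeField (F.P p.K) k (SU N)),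
      |((Nat.card (Set (Site (F.P p.K) 0)) : ℝ))⁻¹ *
            chiRegW F N (FluctV N) θ.ν θ.s2.cR p (gOfRecord₁₃ F N θ p) k Set.univ (pairCfgAt (V := FluctV N) k V' U₀) *
          tkBranchOfRecord F N (FluctV N) θ.ν θ.τ9.M _ p.K (WtOfRecord₁₃ F N θ p) s.init S k
            (fun ω => sect2Operand F N (FluctV N) p.K (settingOfRecord₁₃ F N θ p) (θ.Rz p.K) s t' Ek' (UbgOfRecord₁₃ F N θ p (k + 1) s)
              (S, fun j => (ω j).2) (fun j => (ω j).1)) (pairCfgAt (V := FluctV N) k V' U₀)| ≤ C) :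
    slotsTOfRecord F N θ.ν θ.τ9 (EOfRecord₁₃ F N θ) (wOfRecord₉ F N θ.toStage9Params) θ.ppSel p
        (gOfRecord₁₃ F N θ p) (k + 1) s = 0 ∨
      (fun V' => transportOfRecord F N p.K k (fun U₀ =>
          wOfRecord₉ F N θ.toStage9Params p (gOfRecord₁₃ F N θ p) k s U₀ V' *
            (chiSeqOfRecord F N θ.ν θ.τ9.M (gOfRecord₁₃ F N θ p) p.K k s.init U₀ *
              sect2Slot F N (FluctV N) p.K (settingOfRecord₁₃ F N θ p) (θ.Rz p.K) (WtOfRecord₁₃ F N θ p) s.init t Ek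
                (UbgOfRecord₁₃ F N θ p k s.init) U₀)) V')
        =ᵐ[fieldMeasure (F.P p.K) (k + 1) (SU N)]
      fun V' => ∑ S ∈ admSOfRecord F θ.ν θ.τ9.M (gOfRecord₁₃ F N θ p) p.K k s.init,
        transportOfRecord F N p.K k (fun U₀ =>
          ((Nat.card (Set (Site (F.P p.K) 0)) : ℝ))⁻¹ *
              chiRegW F N (FluctV N) θ.ν θ.s2.cR p (gOfRecord₁₃ F N θ p) k Set.univ (pairCfgAt (V := FluctV N) k V' U₀) *
            tkBranchOfRecord F N (FluctV N) θ.ν θ.τ9.M _ p.K (WtOfRecord₁₃ F N θ p) s.init S k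
              (fun ω => sect2Operand F N (FluctV N) p.K (settingOfRecord₁₃ F N θ p) (θ.Rz p.K) s t' Ek' (UbgOfRecord₁₃ F N θ p (k + 1) s)
                (S, fun j => (ω j).2) (fun j => (ω j).1)) (pairCfgAt (V := FluctV N) k V' U₀)) V' := by
  have hI : ∀ S : ℕ → Set (Site (F.P p.K) 0),
      noExpIntegrandAt F N (FluctV N) p.K k (WtOfRecord₁₃ F N θ p)
          (tkBranchOfRecord F N (FluctV N) θ.ν θ.τ9.M _ p.K (WtOfRecord₁₃ F N θ p) s.init S k
            (fun ω => sect2Operand F N (FluctV N) p.K (settingOfRecord₁₃ F N θ p) (θ.Rz p.K) s t' Ek' (UbgOfRecord₁₃ F N θ p (k + 1) s)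
              (S, fun j => (ω j).2) (fun j => (ω j).1))) =
        fun (V' : GaugeField (F.P p.K) (k + 1) (SU N)) (U₀ : GaugeField (F.P p.K) k (SU N)) =>
          ((Nat.card (Set (Site (F.P p.K) 0)) : ℝ))⁻¹ *
              chiRegW F N (FluctV N) θ.ν θ.s2.cR p (gOfRecord₁₃ F N θ p) k Set.univ (pairCfgAt (V := FluctV N) k V' U₀) *
            tkBranchOfRecord F N (FluctV N) θ.ν θ.τ9.M _ p.K (WtOfRecord₁₃ F N θ p) s.init S k
              (fun ω => sect2Operand F N (FluctV N) p.K (settingOfRecord₁₃ F N θ p) (θ.Rz p.K) s t' Ek' (UbgOfRecord₁₃ F N θ p (k + 1) s)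
                (S, fun j => (ω j).2) (fun j => (ω j).1)) (pairCfgAt (V := FluctV N) k V' U₀) :=
    fun S => funext fun V' => funext fun U₀ => noExpIntegrandAt_WtOfRecord₁₃_of_Zt_eq_ZtOfRecord θ p hZt k _ V' U₀
  have h := tLaw₁₃_coherence_of_Omega_empty θ p hk s hΩ t Ek hid t' Ek' hcl (C := C)
    (fun S hS => by rw [hI S]; exact hm S hS) (fun S hS V' U₀ => by rw [hI S]; exact hC S hS V' U₀)
  simp only [hI] at h
  exact h

end EveryLevel

end Literature.MathematicalPhysics.QuantumFieldTheory.Balaban1983to89.Node00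

end
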